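import Literature.NumberTheory.QuadraticFields.GenusCharacters
import Literature.NumberTheory.QuadraticFields.QuadraticDedekindZetaZeros
import Literature.NumberTheory.QuadraticFields.TwistedDedekindZeta
import Literature.NumberTheory.QuadraticFields.JacobiCharacterPrimitiveProofs
import Literature.NumberTheory.LFunctions.ClassGroupCharacterEulerProduct
import Literature.NumberTheory.LFunctions.ClassGroupLFunctionEntire
import HarnessLib

/-!
# Genus theory of imaginary quadratic fields, III: class group characters of Dirichlet type,
# Kronecker's factorisation `L(s, ψ) ≐ L(s, χ₁) · L(s, χ₁ κ)`, and real zeros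

Topic `NumberTheory/QuadraticFields`, namespace `Literature.NumberTheory.QuadraticFields.Quadratic`
(continuing `GenusCharacters.lean`).  Everything here is PROVED (definitions with bodies,
theorems; no named facts).

Let `K` be a quadratic field, `d = d_K`, `κ = κ_K` its Kronecker character (`ζ_K = ζ · L(κ)`).
A class group character `ψ : Cl_K →* ℂˣ` is **of Dirichlet type** `χ₁` (a Dirichlet character
modulo `N`) if `ψ([𝔮]) = χ₁(N𝔮)` for every prime `𝔮` of norm prime to `N`.  Gauss's genus
characters are of Dirichlet type: `ψ_S = ∏_{p∈S} ψ_p` has `ψ_S([𝔮]) = (N𝔮 / D₁)`, `D₁ = ∏_{p∈S} p`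
(`genusCharProd_agree`).  For such `ψ`, prime by prime, the Euler product of `L(s, ψ)` off the
primes over `N` is that of the Dedekind zeta function twisted by `χ₁`, which factors over `ℚ` by the
decomposition law (the tree's `finprod_primesOver_eq_of_kronecker`):

* `tsum_twist_eq_LSeries_mul_LSeries_of_kronecker` — for ANY quadratic field and Dirichlet `ψ`:
  `Σ_𝔞 ψ(N𝔞) N𝔞^{−s} = L(s, ψ) · L(s, ψκ)` (`Re s > 1`), with `exists_kroneckerChar_values`
  supplying `κ` together with its prime values;
* `classGroupLFunction_mul_prod_eq_tsum_twist` — **Kronecker's factorisation up to the primes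
  over `N`**: `L(s, ψ) · ∏_{𝔮 over N} (1 − ψ(𝔮) N𝔮^{−s}) = Σ_𝔞 χ₁(N𝔞)N𝔞^{−s} = L(s, χ₁) L(s, χ₁κ)`
  for `Re s > 1` (at `𝔮` over `N` the twisted factor is `1`);
* `twistKroneckerChar χ₁ κ = χ₁κ` modulo `N|d|`; `classGroupChar_eq_one_of_primeValue` (a class
  group character trivial on the primes of norm prime to `N` is trivial: every class contains an
  ideal prime to `N`), whence `ne_one_of_agree : ψ ≠ 1 → χ₁ ≠ 1`; `twistKroneckerChar_ne_one` —
  `χ₁κ ≠ 1` too (else the right side has a pole at `s = 1` and the left side does not);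
* `LFunction_mul_LFunction_eq` — the identity continued to all of `ℂ` (`ψ ≠ 1`; identity
  theorem), hence `classGroupLFunction₀_eq_zero_imp`: **every zero of `L(s, ψ)` is a zero of
  `L(s, χ₁)` or of `L(s, χ₁κ)`**;
* `exists_one_sub_realZero_ge_of_agree` — **Siegel's bound for class group characters of
  Dirichlet type**: for every `ε > 0` there is `C(ε) > 0` with `C (N|d_K|)^{−ε} ≤ 1 − β` for every
  quadratic `K`, every `ψ ≠ 1` of Dirichlet type `χ₁ mod N` with `χ₁² = 1`, and every real zero
  `β` of `L(s, ψ)` (the tree's `Siegel.exists_one_sub_realZero_ge` for quadratic Dirichlet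
  characters);
* `genusCharProd`, `genusCharProd_mk0_eq`, `genusCharProd_agree`,
  `exists_one_sub_realZero_genusCharProd_ge` — the genus characters `ψ_S` and the resulting bound
  `C |d_K|^{−ε} ≤ 1 − β` at their real zeros, uniformly over imaginary quadratic fields.

This is the analytic content of genus theory used for Landau–Siegel zeros of class group
`L`-functions (Thorner–Zaman 2019, Thm. 3.3 "Stark's bound", in the imaginary quadratic case).
That EVERY real character of `Cl_K` is of Dirichlet type (Gauss's count of genera with
Dirichlet's theorem) is proved in a sequel.

## References

* [Cox2013] D. A. Cox, *Primes of the form x² + ny²*, 2nd ed. (2013), §3.B Thm. 3.15; §5.B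
  Prop. 5.16; §7.B Thm. 7.7.
* H. Davenport, *Multiplicative Number Theory*, Ch. 6 (Kronecker: `L`-functions of genus
  characters are products of two Dirichlet `L`-functions). [folklore]
* [ThornerZaman2019] J. Thorner, A. Zaman, *A unified and improved Chebotarev density theorem*,
  Algebra & Number Theory 13 (2019), Thm. 3.3 (the use: lower bound for `1 − β₁`).
-/

noncomputable section

open scoped nonZeroDivisors NumberField NumberTheorySymbols
open Module NumberField Ideal IsDedekindDomain Complex Filter Topology
open Literature.NumberTheory.EllipticCurves
open Literature.NumberTheory.LFunctions (exists_isCoprime_mk0_eq)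
open Literature.NumberTheory.LFunctions.NumberField
open Literature.NumberTheory.NumberFields (natPrimeUnder liesOver_natPrimeUnder natPrimeUnder_prime)

namespace Literature.NumberTheory.QuadraticFields.Quadratic

/-! ### The twisted Dedekind zeta function of a quadratic field, any discriminant -/

section Twist

variable {K : Type*} [Field K] [NumberField K]

/-- **`Σ_𝔞 ψ(N𝔞) N𝔞^{−s} = L(s, ψ) L(s, ψκ)` for a quadratic field of any discriminant**, `κ` a
Dirichlet character with the Kronecker values `κ(p) = (d_K/p)` (`p` odd), `κ(2)` by `d_K mod 8`,
`Re s > 1` (twisted Euler product regrouped by rational primes; local factors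
`finprod_primesOver_eq_of_kronecker`). [cite: Cox2013, §5.B Prop. 5.16] -/
theorem tsum_twist_eq_LSeries_mul_LSeries_of_kronecker (h2 : finrank ℚ K = 2) {M : ℕ} [NeZero M]
    (κ : DirichletCharacter ℂ M)
    (hoddp : ∀ p : ℕ, p.Prime → p ≠ 2 → κ p = (J(NumberField.discr K | p) : ℂ))
    (htwo : κ 2 = if NumberField.discr K % 8 = 1 then 1
      else if NumberField.discr K % 8 = 5 then -1 else 0)
    {N : ℕ} [NeZero N] (ψ : DirichletCharacter ℂ N) {s : ℂ} (hs : 1 < s.re) :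
    (∑' I : Ideal (𝓞 K), ψ (absNorm I) * ((absNorm I : ℕ) : ℂ) ^ (-s)) =
      LSeries (fun n => ψ n) s * LSeries (fun n => ψ n * κ n) s := by
  have hs0 : s ≠ 0 := fun h => by rw [h, Complex.zero_re] at hs; linarith
  set f : ℕ →* ℂ := (dirichletSummandHom ψ hs0 : ℕ →* ℂ) with hfdef
  have hf : ∀ n : ℕ, f n = ψ n * (n : ℂ) ^ (-s) := fun n => rfl
  set G : Ideal (𝓞 K) → ℂ := fun P => (1 - f (absNorm P))⁻¹ with hG
  have h1 : HasProd (fun v : HeightOneSpectrum (𝓞 K) => G v.asIdeal)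
      (∑' I : Ideal (𝓞 K), ψ (absNorm I) * ((absNorm I : ℕ) : ℂ) ^ (-s)) :=
    hasProd_twistedEulerFactor K ψ hs
  have h2' := Literature.NumberTheory.NumberFields.HasProd.primesOver_regroup h1
  haveI : NeZero (N * M) := ⟨mul_ne_zero (NeZero.ne N) (NeZero.ne M)⟩
  set ψκ : DirichletCharacter ℂ (N * M) :=
    DirichletCharacter.changeLevel (dvd_mul_right N M) ψ *
      DirichletCharacter.changeLevel (dvd_mul_left M N) κ with hψκ
  have hval : ∀ n : ℕ, ψκ (n : ZMod (N * M)) = ψ n * κ n :=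
    changeLevel_mul_changeLevel_natCast ψ κ
  have h3 : (fun p : Nat.Primes => ∏ᶠ P ∈ primesOver (span {((p : ℕ) : ℤ)}) (𝓞 K), G P) =
      fun p : Nat.Primes => (1 - ψ ((p : ℕ) : ZMod N) * ((p : ℕ) : ℂ) ^ (-s))⁻¹ *
        (1 - ψκ ((p : ℕ) : ZMod (N * M)) * ((p : ℕ) : ℂ) ^ (-s))⁻¹ := by
    funext p
    rw [hG]
    dsimp only
    rw [finprod_primesOver_eq_of_kronecker h2 κ hoddp htwo f p.2, hf, hval]
    ring_nf
  rw [h3] at h2'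
  have h4 := (DirichletCharacter.LSeries_eulerProduct_hasProd ψ hs).mul
    (DirichletCharacter.LSeries_eulerProduct_hasProd ψκ hs)
  rw [h2'.unique h4]
  congr 1
  exact LSeries_congr (fun {n} _ => hval n) s

/-- **The Kronecker character with its prime values**: for `[K : ℚ] = 2` there is a primitive
quadratic Dirichlet character `κ ≠ 1` modulo `|d_K|` with `κ(p) = (d_K/p)` for odd primes `p` and `κ(2) = 1,
−1, 0` according as `d_K ≡ 1, 5 (mod 8)` or `2 ∣ d_K` (odd `d_K`: the Jacobi character and
reciprocity; even `d_K = 4m`: the character of `KroneckerCharacterFourProofs.lean`).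
[cite: Cox2013, §5.B Prop. 5.16] -/
theorem exists_kroneckerChar_values (h2 : finrank ℚ K = 2) :
    ∃ (M : ℕ) (_ : NeZero M) (κ : DirichletCharacter ℂ M), M = (NumberField.discr K).natAbs ∧ κ ≠ 1 ∧
      κ ^ 2 = 1 ∧ κ.IsPrimitive ∧ (∀ p : ℕ, p.Prime → p ≠ 2 → κ p = (J(NumberField.discr K | p) : ℂ)) ∧
      κ 2 = (if NumberField.discr K % 8 = 1 then 1
        else if NumberField.discr K % 8 = 5 then -1 else 0) := by
  rcases isFundamentalDiscriminant_discr (K := K) h2 with ⟨h1, hsqf, -⟩ | ⟨h4, hm4, hsq⟩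
  · -- odd discriminant: the Jacobi character modulo `|d|`
    have hodd : Odd (NumberField.discr K) := by rw [Int.odd_iff]; omega
    haveI := neZero_natAbs_discr (K := K)
    have hd4 : NumberField.discr K % 4 = 1 := discr_emod_four_eq_one h2 hodd
    have hoddD : Odd (NumberField.discr K).natAbs := Int.natAbs_odd.mpr hodd
    have hsqD : Squarefree (NumberField.discr K).natAbs := Int.squarefree_natAbs.mpr hsqf
    refine ⟨(NumberField.discr K).natAbs, inferInstance, jacobiChar (NumberField.discr K).natAbs, rfl,
      jacobiChar_natAbs_discr_ne_one h2 hodd,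
      MulChar.IsQuadratic.sq_eq_one (fun a ↦ jacobiChar_trichotomy a),
      isPrimitive_jacobiChar hoddD hsqD, fun p hp hp2 ↦ ?_, ?_⟩
    · rw [jacobiChar_natCast, jacobiSym_natAbs_eq_of_emod_four_eq_one hd4 (hp.odd_of_ne_two hp2)]
    · rw [show (2 : ZMod (NumberField.discr K).natAbs) = ((2 : ℕ) : ZMod _) by norm_cast,
        jacobiChar_natCast]
      by_cases h81 : NumberField.discr K % 8 = 1
      · rw [if_pos h81, show ((2 : ℕ) : ℤ) = 2 by rfl, (jacobiSym_two_natAbs_eq_one_iff hd4).mpr h81]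
        simp
      · rw [if_neg h81]
        have h85 : NumberField.discr K % 8 = 5 := by omega
        rw [if_pos h85, show ((2 : ℕ) : ℤ) = 2 by rfl,
          (jacobiSym_two_natAbs_eq_neg_one_iff hd4).mpr h85]
        simp
  · -- even discriminant `d = 4m`
    set m : ℤ := NumberField.discr K / 4 with hm
    have hm0 : m ≠ 0 := hsq.ne_zero
    have hdm : NumberField.discr K = 4 * m := by rw [hm, Int.mul_ediv_cancel' h4]
    haveI : NeZero (4 * m.natAbs) := ⟨mul_ne_zero (by norm_num) (Int.natAbs_ne_zero.mpr hm0)⟩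
    obtain ⟨κ, hκ⟩ := exists_dirichletCharacter_four_mul m hm0
    have hprim : κ.IsPrimitive := isPrimitive_of_forall_odd hm4 hsq hκ
    have hM : 4 * m.natAbs = (NumberField.discr K).natAbs := by
      rw [hdm, Int.natAbs_mul]; rfl
    have hne : κ ≠ 1 := by
      intro h
      have hc : κ.conductor = 4 * m.natAbs := hprim
      rw [h, DirichletCharacter.conductor_one] at hc
      have := Int.natAbs_pos.mpr hm0
      omega
    refine ⟨4 * m.natAbs, inferInstance, κ, hM, hne, (isQuadratic_of_forall_odd hm0 hκ).sq_eq_one,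
      hprim, fun p hp hp2 ↦ ?_, ?_⟩
    · have hpodd : Odd p := hp.odd_of_ne_two hp2
      rw [hκ p hpodd, hdm, jacobiSym.mul_left]
      have h4' : J(4 | p) = 1 := by
        rw [show (4 : ℤ) = 2 ^ 2 by norm_num]
        exact jacobiSym.sq_one' (by
          rw [show (2 : ℤ) = ((2 : ℕ) : ℤ) by rfl, Int.gcd_natCast_natCast]
          exact (Nat.coprime_primes Nat.prime_two hp).mpr (Ne.symm hp2))
      rw [h4', one_mul]
    · have h81 : NumberField.discr K % 8 ≠ 1 := by omega
      have h85 : NumberField.discr K % 8 ≠ 5 := by omega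
      rw [if_neg h81, if_neg h85]
      refine apply_eq_zero_of_even (m := m) ?_
      have hlt : 2 < 4 * m.natAbs := by have := Int.natAbs_pos.mpr hm0; omega
      have : ((2 : ℕ) : ZMod (4 * m.natAbs)) = 2 := by norm_cast
      rw [← this, ZMod.val_natCast, Nat.mod_eq_of_lt hlt]
      exact even_two

end Twist

/-! ### Primes over `N` and norms prime to `N` -/

section Primes

variable {K : Type*} [Field K] [NumberField K]

/-- A prime `v` of `K` whose norm is divisible by `p` lies over `p`: `natPrimeUnder v = p`.
[folklore] -/
theorem natPrimeUnder_eq_of_dvd_absNorm (v : HeightOneSpectrum (𝓞 K)) {p : ℕ} (hp : p.Prime)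
    (hdvd : p ∣ Ideal.absNorm v.asIdeal) : natPrimeUnder v.asIdeal = p := by
  have hq : (natPrimeUnder v.asIdeal).Prime := natPrimeUnder_prime v.isPrime v.ne_bot
  haveI := liesOver_natPrimeUnder v.asIdeal
  have hN := Ideal.absNorm_eq_pow_inertiaDeg' v.asIdeal hq
  rw [hN] at hdvd
  exact ((Nat.prime_dvd_prime_iff_eq hp hq).mp (hp.dvd_of_dvd_pow hdvd)).symm

omit [NumberField K] in
/-- If `v` lies over `p` then `(p : 𝓞 K) ∈ v`. [folklore] -/
theorem natCast_mem_of_natPrimeUnder_eq (v : HeightOneSpectrum (𝓞 K)) {p : ℕ}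
    (h : natPrimeUnder v.asIdeal = p) : (p : 𝓞 K) ∈ v.asIdeal := by
  have hl := (liesOver_natPrimeUnder v.asIdeal).over
  have : algebraMap ℤ (𝓞 K) (p : ℤ) ∈ v.asIdeal := by
    rw [← Ideal.mem_comap]
    change (p : ℤ) ∈ v.asIdeal.under ℤ
    rw [← hl, ← h]
    exact Ideal.mem_span_singleton_self _
  simpa using this

/-- `N v` is a power of the prime under `v`, with positive exponent. [folklore] -/
theorem exists_absNorm_eq_natPrimeUnder_pow (v : HeightOneSpectrum (𝓞 K)) :
    ∃ k : ℕ, k ≠ 0 ∧ Ideal.absNorm v.asIdeal = natPrimeUnder v.asIdeal ^ k := by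
  have hq : (natPrimeUnder v.asIdeal).Prime := natPrimeUnder_prime v.isPrime v.ne_bot
  haveI := liesOver_natPrimeUnder v.asIdeal
  refine ⟨_, ?_, Ideal.absNorm_eq_pow_inertiaDeg' v.asIdeal hq⟩
  intro h0
  have hN := Ideal.absNorm_eq_pow_inertiaDeg' v.asIdeal hq
  rw [h0, pow_zero] at hN
  have := Literature.NumberTheory.LFunctions.AbelianDensity.two_le_absNorm K v
  omega

/-- `p ∣ N v` when `v` lies over `p`. [folklore] -/
theorem dvd_absNorm_of_natPrimeUnder_eq (v : HeightOneSpectrum (𝓞 K)) {p : ℕ}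
    (h : natPrimeUnder v.asIdeal = p) : p ∣ Ideal.absNorm v.asIdeal := by
  obtain ⟨k, hk, hN⟩ := exists_absNorm_eq_natPrimeUnder_pow v
  rw [hN, h]
  exact dvd_pow_self p hk

/-- **The norm of `v` is prime to `N` unless `v` lies over a prime divisor of `N`.** [folklore] -/
theorem coprime_absNorm_of_not_dvd (v : HeightOneSpectrum (𝓞 K)) {N : ℕ}
    (h : ¬ natPrimeUnder v.asIdeal ∣ N) : (Ideal.absNorm v.asIdeal).Coprime N := by
  obtain ⟨k, -, hN⟩ := exists_absNorm_eq_natPrimeUnder_pow v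
  rw [hN]
  exact Nat.Coprime.pow_left _ ((natPrimeUnder_prime v.isPrime v.ne_bot).coprime_iff_not_dvd.mpr h)

variable (K) in
/-- The (finite) set of primes of `K` above the prime divisors of `N ≠ 0`. [folklore] -/
def badPrimes (N : ℕ) [NeZero N] : Finset (HeightOneSpectrum (𝓞 K)) :=
  (Ideal.finite_factors (I := span {((N : ℕ) : 𝓞 K)}) (by
    rw [Ne, Submodule.zero_eq_bot, Ideal.span_singleton_eq_bot]
    exact_mod_cast NeZero.ne N)).toFinset.filter (fun v ↦ natPrimeUnder v.asIdeal ∣ N)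

/-- Membership in `badPrimes`. [folklore] -/
theorem mem_badPrimes {N : ℕ} [NeZero N] {v : HeightOneSpectrum (𝓞 K)} :
    v ∈ badPrimes K N ↔ natPrimeUnder v.asIdeal ∣ N := by
  rw [badPrimes, Finset.mem_filter, Set.Finite.mem_toFinset, Set.mem_setOf_eq]
  constructor
  · exact fun h ↦ h.2
  · intro h
    refine ⟨?_, h⟩
    rw [Ideal.dvd_span_singleton]
    have hp : (natPrimeUnder v.asIdeal : 𝓞 K) ∈ v.asIdeal := natCast_mem_of_natPrimeUnder_eq v rfl
    obtain ⟨c, hc⟩ := h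
    rw [hc, Nat.cast_mul]
    exact Ideal.mul_mem_right _ _ hp

/-- Off `badPrimes N`, the norm is prime to `N`. [folklore] -/
theorem coprime_absNorm_of_not_mem_badPrimes {N : ℕ} [NeZero N] {v : HeightOneSpectrum (𝓞 K)}
    (hv : v ∉ badPrimes K N) : (Ideal.absNorm v.asIdeal).Coprime N :=
  coprime_absNorm_of_not_dvd v fun h ↦ hv (mem_badPrimes.mpr h)

/-- On `badPrimes N`, the norm is NOT prime to `N` (`N ≠ 0`). [folklore] -/
theorem not_coprime_absNorm_of_mem_badPrimes {N : ℕ} [NeZero N] {v : HeightOneSpectrum (𝓞 K)}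
    (hv : v ∈ badPrimes K N) : ¬ (Ideal.absNorm v.asIdeal).Coprime N := by
  intro h
  have hp := mem_badPrimes.mp hv
  have hq : (natPrimeUnder v.asIdeal).Prime := natPrimeUnder_prime v.isPrime v.ne_bot
  have h1 : natPrimeUnder v.asIdeal ∣ Nat.gcd (Ideal.absNorm v.asIdeal) N :=
    Nat.dvd_gcd (dvd_absNorm_of_natPrimeUnder_eq v rfl) hp
  rw [h] at h1
  exact hq.ne_one (Nat.dvd_one.mp h1)

/-- A prime ideal coprime to `(N)` has norm prime to `N`. [folklore] -/
theorem coprime_absNorm_of_isCoprime_span {N : ℕ} (v : HeightOneSpectrum (𝓞 K))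
    (hcop : IsCoprime v.asIdeal (Ideal.span {(N : 𝓞 K)})) : (Ideal.absNorm v.asIdeal).Coprime N := by
  refine coprime_absNorm_of_not_dvd v fun hdvd ↦ ?_
  have hp : (natPrimeUnder v.asIdeal : 𝓞 K) ∈ v.asIdeal := natCast_mem_of_natPrimeUnder_eq v rfl
  have hN : (N : 𝓞 K) ∈ v.asIdeal := by
    obtain ⟨c, hc⟩ := hdvd
    rw [hc, Nat.cast_mul]
    exact Ideal.mul_mem_right _ _ hp
  have hle : Ideal.span {(N : 𝓞 K)} ≤ v.asIdeal := (Ideal.span_singleton_le_iff_mem _).mpr hN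
  have htop : v.asIdeal = ⊤ := by
    have := Ideal.isCoprime_iff_sup_eq.mp hcop
    rwa [sup_eq_left.mpr hle] at this
  exact v.isPrime.ne_top htop

/-- **A class group character trivial on the primes of norm prime to `N` is trivial** (every
class contains an integral ideal prime to `(N)`, Neukirch VI (1.9), which factors into primes of
norm prime to `N`). [cite: NeukirchANT1999, Ch. VI §1 (1.9)] -/
theorem classGroupChar_eq_one_of_primeValue {N : ℕ} (hN : N ≠ 0) (ψ : ClassGroup (𝓞 K) →* ℂˣ)
    (h : ∀ v : HeightOneSpectrum (𝓞 K), (Ideal.absNorm v.asIdeal).Coprime N →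
      classGroupCharPrimeValue ψ v = 1) : ψ = 1 := by
  -- every integral ideal coprime to `(N)` has `ψ = 1`
  have key : ∀ (I : Ideal (𝓞 K)) (hI : I ≠ ⊥), IsCoprime I (Ideal.span {(N : 𝓞 K)}) →
      (ψ (ClassGroup.mk0 ⟨I, mem_nonZeroDivisors_of_ne_zero hI⟩) : ℂ) = 1 := by
    intro I
    induction I using UniqueFactorizationMonoid.induction_on_prime with
    | h₁ => intro hI; exact (hI rfl).elim
    | h₂ I hu =>
        intro hI _
        have hT : I = ⊤ := Ideal.isUnit_iff.mp hu
        subst hT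
        exact classGroupChar_mk0_top ψ _
    | h₃ I P hI0 hP ih =>
        intro hIP hcop
        have hP0 : P ≠ ⊥ := hP.ne_zero
        have hPp : P.IsPrime := (Ideal.prime_iff_isPrime hP0).mp hP
        have hcopI : IsCoprime I (Ideal.span {(N : 𝓞 K)}) := hcop.of_mul_left_right
        have hcopP : IsCoprime P (Ideal.span {(N : 𝓞 K)}) := hcop.of_mul_left_left
        have e : ClassGroup.mk0 ⟨P * I, mem_nonZeroDivisors_of_ne_zero hIP⟩ =
            ClassGroup.mk0 ⟨P, mem_nonZeroDivisors_of_ne_zero hP0⟩ *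
              ClassGroup.mk0 ⟨I, mem_nonZeroDivisors_of_ne_zero hI0⟩ := by
          rw [← map_mul]; rfl
        rw [e, map_mul, Units.val_mul, ih hI0 hcopI, mul_one]
        have := h ⟨P, hPp, hP0⟩ (coprime_absNorm_of_isCoprime_span ⟨P, hPp, hP0⟩ hcopP)
        rwa [classGroupCharPrimeValue_apply] at this
  refine MonoidHom.ext fun c ↦ Units.val_injective ?_
  have hN' : Ideal.span {(N : 𝓞 K)} ≠ ⊥ := by
    rw [Ne, Ideal.span_singleton_eq_bot]; exact_mod_cast hN
  obtain ⟨I, hI, hcop, hcls⟩ := exists_isCoprime_mk0_eq hN' c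
  rw [MonoidHom.one_apply, Units.val_one, ← hcls]
  exact key I hI hcop

end Primes

/-! ### Class group characters of Dirichlet type: Kronecker's factorisation -/

section DirichletType

variable {K : Type*} [Field K] [NumberField K]
variable {ψ : ClassGroup (𝓞 K) →* ℂˣ} {N : ℕ} [NeZero N] {χ₁ : DirichletCharacter ℂ N}

/-- **`ψ ≠ 1 ⟹ χ₁ ≠ 1`** for `ψ` of Dirichlet type `χ₁`. [folklore] -/
theorem ne_one_of_agree (hψ : ψ ≠ 1)
    (hagree : ∀ v : HeightOneSpectrum (𝓞 K), (Ideal.absNorm v.asIdeal).Coprime N →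
      classGroupCharPrimeValue ψ v = χ₁ (Ideal.absNorm v.asIdeal)) : χ₁ ≠ 1 := by
  intro h1
  refine hψ (classGroupChar_eq_one_of_primeValue (NeZero.ne N) ψ fun v hv ↦ ?_)
  rw [hagree v hv, h1, MulChar.one_apply]
  exact (ZMod.isUnit_iff_coprime _ _).mpr hv

/-- **Kronecker's factorisation up to the primes over `N`** (`Re s > 1`): for `ψ` of Dirichlet
type `χ₁ mod N`, `L(s, ψ) · ∏_{𝔮 over N} (1 − ψ(𝔮) N𝔮^{−s}) = Σ_𝔞 χ₁(N𝔞) N𝔞^{−s}`: the two Euler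
products agree at every prime not over `N`, and at `𝔮` over `N` the twisted factor is `1`
(`χ₁(N𝔮) = 0`). [cite: Cox2013, §3.B Thm. 3.15] -/
theorem classGroupLFunction_mul_prod_eq_tsum_twist
    (hagree : ∀ v : HeightOneSpectrum (𝓞 K), (Ideal.absNorm v.asIdeal).Coprime N →
      classGroupCharPrimeValue ψ v = χ₁ (Ideal.absNorm v.asIdeal)) {s : ℂ} (hs : 1 < s.re) :
    classGroupLFunction K ψ s *
        ∏ v ∈ badPrimes K N, (1 - classGroupCharPrimeValue ψ v * ((Ideal.absNorm v.asIdeal : ℕ) : ℂ) ^ (-s)) =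
      ∑' I : Ideal (𝓞 K), χ₁ (absNorm I) * ((absNorm I : ℕ) : ℂ) ^ (-s) := by
  classical
  set 𝒮 := badPrimes K N with h𝒮
  set z : HeightOneSpectrum (𝓞 K) → ℂ := fun v ↦ ((Ideal.absNorm v.asIdeal : ℕ) : ℂ) ^ (-s) with hz
  have hL := hasProd_classGroupLFunction K ψ hs
  have hT := hasProd_twistedEulerFactor K χ₁ hs
  set e : HeightOneSpectrum (𝓞 K) → ℂ := fun v ↦
    if v ∈ 𝒮 then 1 - classGroupCharPrimeValue ψ v * z v else 1 with he
  have hE : HasProd e (∏ v ∈ 𝒮, e v) :=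
    hasProd_prod_of_ne_finset_one (fun v hv ↦ by rw [he]; exact if_neg hv)
  have hprod := hL.mul hE
  have hloc : ∀ v : HeightOneSpectrum (𝓞 K),
      (1 - classGroupCharPrimeValue ψ v * z v)⁻¹ * e v = (1 - χ₁ (absNorm v.asIdeal) * z v)⁻¹ := by
    intro v
    by_cases hv : v ∈ 𝒮
    · rw [he]; dsimp only; rw [if_pos hv]
      have h0 : χ₁ (absNorm v.asIdeal) = 0 :=
        MulChar.map_nonunit χ₁ (mt (ZMod.isUnit_iff_coprime _ _).mp (not_coprime_absNorm_of_mem_badPrimes hv))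
      rw [h0, zero_mul, sub_zero, inv_one]
      refine inv_mul_cancel₀ (sub_ne_zero.mpr (Ne.symm ?_))
      intro h1
      have this : ‖classGroupCharPrimeValue ψ v * z v‖ < 1 :=
        norm_classGroupCharPrimeValue_mul_cpow_lt_one ψ v (by linarith : 0 < s.re)
      rw [h1, norm_one] at this
      exact lt_irrefl _ this
    · rw [he]; dsimp only; rw [if_neg hv, mul_one, hagree v (coprime_absNorm_of_not_mem_badPrimes hv)]
  have hprod' : HasProd (fun v : HeightOneSpectrum (𝓞 K) ↦ (1 - χ₁ (absNorm v.asIdeal) * z v)⁻¹)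
      (classGroupLFunction K ψ s * ∏ v ∈ 𝒮, e v) :=
    hprod.congr_fun fun v ↦ (hloc v).symm
  have he' : ∏ v ∈ 𝒮, e v = ∏ v ∈ 𝒮, (1 - classGroupCharPrimeValue ψ v * z v) :=
    Finset.prod_congr rfl fun v hv ↦ by rw [he]; exact if_pos hv
  rw [← he']
  exact hprod'.unique hT

/-- **The Dirichlet character `χ₁ κ` modulo `N M`** (`κ` the Kronecker character of `K` modulo
`M = |d_K|`). [folklore] -/
def twistKroneckerChar {N : ℕ} [NeZero N] (χ₁ : DirichletCharacter ℂ N) {M : ℕ} [NeZero M]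
    (κ : DirichletCharacter ℂ M) : DirichletCharacter ℂ (N * M) :=
  DirichletCharacter.changeLevel (dvd_mul_right N M) χ₁ *
    DirichletCharacter.changeLevel (dvd_mul_left M N) κ

/-- Values: `(χ₁κ)(n) = χ₁(n) κ(n)`. [folklore] -/
theorem twistKroneckerChar_natCast {M : ℕ} [NeZero M] (κ : DirichletCharacter ℂ M) (n : ℕ) :
    twistKroneckerChar χ₁ κ n = χ₁ n * κ n :=
  changeLevel_mul_changeLevel_natCast χ₁ κ n

/-- `χ₁κ` is quadratic when `χ₁` and `κ` are. [folklore] -/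
theorem twistKroneckerChar_sq {M : ℕ} [NeZero M] {κ : DirichletCharacter ℂ M}
    (hχ₁ : χ₁ ^ 2 = 1) (hκ : κ ^ 2 = 1) : twistKroneckerChar χ₁ κ ^ 2 = 1 := by
  rw [twistKroneckerChar, mul_pow, ← map_pow, ← map_pow, hχ₁, hκ, map_one, map_one, mul_one]

/-- The right-hand side `L₀(s, ψ) ∏_{𝔮 over N} (1 − ψ(𝔮) N𝔮^{−s})` is entire. [folklore] -/
theorem differentiable_classGroupLFunction₀_mul_prod (ψ : ClassGroup (𝓞 K) →* ℂˣ) (N : ℕ) [NeZero N] :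
    Differentiable ℂ fun s : ℂ ↦ classGroupLFunction₀ K ψ s *
      ∏ v ∈ badPrimes K N, (1 - classGroupCharPrimeValue ψ v * ((Ideal.absNorm v.asIdeal : ℕ) : ℂ) ^ (-s)) := by
  refine (differentiable_classGroupLFunction₀ _).mul ?_
  refine Differentiable.fun_finsetProd fun v _ ↦ ?_
  refine (differentiable_const _).sub ((differentiable_const _).mul ?_)
  refine Differentiable.const_cpow differentiable_neg (Or.inl ?_)
  have := Literature.NumberTheory.LFunctions.AbelianDensity.two_le_absNorm K v
  exact_mod_cast (show Ideal.absNorm v.asIdeal ≠ 0 by omega)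

variable (h2 : finrank ℚ K = 2) {M : ℕ} [NeZero M] (κ : DirichletCharacter ℂ M)
  (hoddp : ∀ p : ℕ, p.Prime → p ≠ 2 → κ p = (J(NumberField.discr K | p) : ℂ))
  (htwo : κ 2 = if NumberField.discr K % 8 = 1 then 1
    else if NumberField.discr K % 8 = 5 then -1 else 0)
include h2 hoddp htwo

/-- **Kronecker's factorisation on `Re s > 1`, with `L`-functions** (`ψ ≠ 1` of Dirichlet type
`χ₁`): `L(s, χ₁) L(s, χ₁κ) = L₀(s, ψ) ∏_{𝔮 over N}(1 − ψ(𝔮) N𝔮^{−s})`. [cite: Cox2013, §3.B Thm. 3.15] -/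
theorem LFunction_mul_LFunction_eq_of_one_lt_re (hψ : ψ ≠ 1)
    (hagree : ∀ v : HeightOneSpectrum (𝓞 K), (Ideal.absNorm v.asIdeal).Coprime N →
      classGroupCharPrimeValue ψ v = χ₁ (Ideal.absNorm v.asIdeal)) {s : ℂ} (hs : 1 < s.re) :
    χ₁.LFunction s * (twistKroneckerChar χ₁ κ).LFunction s =
      classGroupLFunction₀ K ψ s *
        ∏ v ∈ badPrimes K N, (1 - classGroupCharPrimeValue ψ v * ((Ideal.absNorm v.asIdeal : ℕ) : ℂ) ^ (-s)) := by
  have hs1 : s ≠ 1 := fun h ↦ by rw [h, Complex.one_re] at hs; exact lt_irrefl _ hs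
  rw [DirichletCharacter.LFunction_eq_LSeries _ hs, DirichletCharacter.LFunction_eq_LSeries _ hs,
    classGroupLFunction₀_eq _ hs1 hψ, classGroupLFunction_mul_prod_eq_tsum_twist hagree hs,
    tsum_twist_eq_LSeries_mul_LSeries_of_kronecker h2 κ hoddp htwo χ₁ hs]
  congr 1
  exact LSeries_congr (fun {n} _ ↦ twistKroneckerChar_natCast κ n) s

/-- **`χ₁κ ≠ 1` when `ψ ≠ 1`**: otherwise `L(s, χ₁κ) = ζ(s) ∏_{p ∣ NM}(1 − p^{−s})` and the left
side of Kronecker's factorisation has a pole at `s = 1` (`L(1, χ₁) ≠ 0`), while the right side is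
entire. [cite: Cox2013, §3.B Thm. 3.15] -/
theorem twistKroneckerChar_ne_one (hψ : ψ ≠ 1)
    (hagree : ∀ v : HeightOneSpectrum (𝓞 K), (Ideal.absNorm v.asIdeal).Coprime N →
      classGroupCharPrimeValue ψ v = χ₁ (Ideal.absNorm v.asIdeal)) :
    twistKroneckerChar χ₁ κ ≠ 1 := by
  intro h1
  have hχ₁ : χ₁ ≠ 1 := ne_one_of_agree hψ hagree
  set F₂ : ℂ → ℂ := fun s ↦ classGroupLFunction₀ K ψ s *
      ∏ v ∈ badPrimes K N, (1 - classGroupCharPrimeValue ψ v *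
        ((Ideal.absNorm v.asIdeal : ℕ) : ℂ) ^ (-s)) with hF₂
  have hF₂d : Differentiable ℂ F₂ := differentiable_classGroupLFunction₀_mul_prod ψ N
  set g : ℝ → ℂ := fun σ ↦ ((σ : ℂ) - 1) * F₂ σ with hg
  -- (i) `g → 0`
  have hg0 : Tendsto g (𝓝[>] (1 : ℝ)) (𝓝 0) := by
    have hc : Continuous g :=
      ((Complex.continuous_ofReal.sub continuous_const)).mul (hF₂d.continuous.comp Complex.continuous_ofReal)
    have := hc.tendsto 1
    rw [show g 1 = 0 by simp [hg]] at this
    exact this.mono_left nhdsWithin_le_nhds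
  -- (ii) for `σ > 1`, `g(σ) = L(σ, χ₁) · ((σ − 1) L(σ, 1))`, tending to `L(1, χ₁) ∏ (1 − p⁻¹) ≠ 0`
  set N₂ : ℕ := N * M with hN₂
  have hlim : Tendsto (fun σ : ℝ ↦ χ₁.LFunction σ *
      (((σ : ℂ) - 1) * DirichletCharacter.LFunctionTrivChar N₂ σ)) (𝓝[>] (1 : ℝ))
      (𝓝 (χ₁.LFunction 1 * ∏ p ∈ N₂.primeFactors, (1 - (p : ℂ)⁻¹))) := by
    refine Tendsto.mul ?_ ?_
    · have hc : Continuous fun σ : ℝ ↦ χ₁.LFunction σ :=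
        (DirichletCharacter.differentiable_LFunction hχ₁).continuous.comp Complex.continuous_ofReal
      have := hc.tendsto 1
      simp only [Complex.ofReal_one] at this
      exact this.mono_left nhdsWithin_le_nhds
    · exact (DirichletCharacter.LFunctionTrivChar_residue_one (N := N₂)).comp tendsto_ofReal_nhdsGT_one
  have heq : g =ᶠ[𝓝[>] (1 : ℝ)] fun σ : ℝ ↦ χ₁.LFunction σ *
      (((σ : ℂ) - 1) * DirichletCharacter.LFunctionTrivChar N₂ σ) := by
    filter_upwards [self_mem_nhdsWithin] with σ hσ
    have hσ' : 1 < (σ : ℂ).re := by simpa using hσ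
    have := LFunction_mul_LFunction_eq_of_one_lt_re h2 κ hoddp htwo hψ hagree hσ'
    rw [h1] at this
    simp only [hg, hF₂]
    rw [← this, DirichletCharacter.LFunctionTrivChar]
    ring
  have hlim' := hlim.congr' heq.symm
  have hval := tendsto_nhds_unique hg0 hlim'
  have hne : χ₁.LFunction 1 * ∏ p ∈ N₂.primeFactors, (1 - (p : ℂ)⁻¹) ≠ 0 := by
    refine mul_ne_zero (DirichletCharacter.LFunction_apply_one_ne_zero hχ₁) ?_
    refine Finset.prod_ne_zero_iff.mpr fun p hp ↦ ?_
    have hp' := Nat.prime_of_mem_primeFactors hp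
    rw [sub_ne_zero, Ne, eq_comm, inv_eq_one]
    exact_mod_cast hp'.ne_one
  exact hne hval.symm

/-- **Kronecker's factorisation, continued to all of `ℂ`** (`ψ ≠ 1` of Dirichlet type `χ₁`):
`L(s, χ₁) L(s, χ₁κ) = L₀(s, ψ) ∏_{𝔮 over N}(1 − ψ(𝔮) N𝔮^{−s})` for every `s` (both sides entire;
identity theorem). [cite: Cox2013, §3.B Thm. 3.15] -/
theorem LFunction_mul_LFunction_eq (hψ : ψ ≠ 1)
    (hagree : ∀ v : HeightOneSpectrum (𝓞 K), (Ideal.absNorm v.asIdeal).Coprime N →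
      classGroupCharPrimeValue ψ v = χ₁ (Ideal.absNorm v.asIdeal)) (s : ℂ) :
    χ₁.LFunction s * (twistKroneckerChar χ₁ κ).LFunction s =
      classGroupLFunction₀ K ψ s *
        ∏ v ∈ badPrimes K N, (1 - classGroupCharPrimeValue ψ v * ((Ideal.absNorm v.asIdeal : ℕ) : ℂ) ^ (-s)) := by
  have hχ₁ : χ₁ ≠ 1 := ne_one_of_agree hψ hagree
  have hκ₂ : twistKroneckerChar χ₁ κ ≠ 1 := twistKroneckerChar_ne_one h2 κ hoddp htwo hψ hagree
  set F₁ : ℂ → ℂ := fun s ↦ χ₁.LFunction s * (twistKroneckerChar χ₁ κ).LFunction s with hF₁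
  set F₂ : ℂ → ℂ := fun s ↦ classGroupLFunction₀ K ψ s *
      ∏ v ∈ badPrimes K N, (1 - classGroupCharPrimeValue ψ v *
        ((Ideal.absNorm v.asIdeal : ℕ) : ℂ) ^ (-s)) with hF₂
  have hF₁d : Differentiable ℂ F₁ :=
    (DirichletCharacter.differentiable_LFunction hχ₁).mul (DirichletCharacter.differentiable_LFunction hκ₂)
  have hF₂d : Differentiable ℂ F₂ := differentiable_classGroupLFunction₀_mul_prod ψ N
  have hA₁ : AnalyticOnNhd ℂ F₁ Set.univ := analyticOnNhd_univ_iff_differentiable.mpr hF₁d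
  have hA₂ : AnalyticOnNhd ℂ F₂ Set.univ := analyticOnNhd_univ_iff_differentiable.mpr hF₂d
  have hev : F₁ =ᶠ[𝓝 (2 : ℂ)] F₂ := by
    refine Filter.eventuallyEq_iff_exists_mem.mpr ⟨{z : ℂ | 1 < z.re},
      (isOpen_lt continuous_const Complex.continuous_re).mem_nhds (by simp), fun z hz ↦ ?_⟩
    exact LFunction_mul_LFunction_eq_of_one_lt_re h2 κ hoddp htwo hψ hagree hz
  have := hA₁.eqOn_of_preconnected_of_eventuallyEq hA₂ isPreconnected_univ (Set.mem_univ 2) hev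
  exact this (Set.mem_univ s)

/-- **Every zero of `L(s, ψ)` is a zero of `L(s, χ₁)` or of `L(s, χ₁κ)`** (`ψ ≠ 1` of Dirichlet
type `χ₁`; `L₀(s, ψ)` is the entire function equal to `L(s, ψ)` off `s = 1`).
[cite: Cox2013, §3.B Thm. 3.15] -/
theorem classGroupLFunction₀_eq_zero_imp (hψ : ψ ≠ 1)
    (hagree : ∀ v : HeightOneSpectrum (𝓞 K), (Ideal.absNorm v.asIdeal).Coprime N →
      classGroupCharPrimeValue ψ v = χ₁ (Ideal.absNorm v.asIdeal)) {s : ℂ}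
    (h0 : classGroupLFunction₀ K ψ s = 0) :
    χ₁.LFunction s = 0 ∨ (twistKroneckerChar χ₁ κ).LFunction s = 0 := by
  have := LFunction_mul_LFunction_eq h2 κ hoddp htwo hψ hagree s
  rw [h0, zero_mul] at this
  exact mul_eq_zero.mp this

end DirichletType

/-! ### Siegel's bound for class group characters of Dirichlet type -/

/-- **Lower bound for `1 − β` at real zeros of `L(s, ψ)`, `ψ` of Dirichlet type, uniformly over
quadratic fields**: for every `ε > 0` there is `C(ε) > 0` such that for every quadratic field `K`,
every Dirichlet character `χ₁ mod N` with `χ₁² = 1`, every class group character `ψ ≠ 1` with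
`ψ([𝔮]) = χ₁(N𝔮)` for all primes `𝔮` of norm prime to `N`, and every real `β` with
`L₀(β, ψ) = 0`: `C (N |d_K|)^{−ε} ≤ 1 − β` (Kronecker's factorisation and Siegel's theorem for the
quadratic Dirichlet characters `χ₁ mod N` and `χ₁κ mod N|d_K|`). [cite: ThornerZaman2019, Thm. 3.3] -/
theorem exists_one_sub_realZero_ge_of_agree {ε : ℝ} (hε : 0 < ε) :
    ∃ C : ℝ, 0 < C ∧ ∀ (K : Type) [Field K] [NumberField K], finrank ℚ K = 2 →
      ∀ (N : ℕ) [NeZero N] (χ₁ : DirichletCharacter ℂ N), χ₁ ^ 2 = 1 →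
      ∀ (ψ : ClassGroup (𝓞 K) →* ℂˣ), ψ ≠ 1 →
        (∀ v : HeightOneSpectrum (𝓞 K), (Ideal.absNorm v.asIdeal).Coprime N →
          classGroupCharPrimeValue ψ v = χ₁ (Ideal.absNorm v.asIdeal)) →
        ∀ β : ℝ, classGroupLFunction₀ K ψ β = 0 →
          C * ((N : ℝ) * |(NumberField.discr K : ℝ)|) ^ (-ε) ≤ 1 - β := by
  obtain ⟨C, hC, hSiegel⟩ :=
    Literature.NumberTheory.LFunctions.Siegel.exists_one_sub_realZero_ge hε
  refine ⟨C, hC, fun K _ _ h2 N _ χ₁ hχ₁2 ψ hψ hagree β hβ ↦ ?_⟩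
  obtain ⟨M, hM, κ, hMd, hκ1, hκ2, -, hoddp, htwo⟩ := exists_kroneckerChar_values (K := K) h2
  have hχ₁ : χ₁ ≠ 1 := ne_one_of_agree hψ hagree
  have hκ₂ : twistKroneckerChar χ₁ κ ≠ 1 := twistKroneckerChar_ne_one h2 κ hoddp htwo hψ hagree
  have hκ₂2 : twistKroneckerChar χ₁ κ ^ 2 = 1 := twistKroneckerChar_sq hχ₁2 hκ2
  have hd0 : 0 < (NumberField.discr K).natAbs := Int.natAbs_pos.mpr (NumberField.discr_ne_zero K)
  have hdR : ((NumberField.discr K).natAbs : ℝ) = |(NumberField.discr K : ℝ)| := by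
    rw [Nat.cast_natAbs, Int.cast_abs]
  have hd1 : (1 : ℝ) ≤ |(NumberField.discr K : ℝ)| := by rw [← hdR]; exact_mod_cast hd0
  have hN1 : (1 : ℝ) ≤ N := by exact_mod_cast Nat.pos_of_ne_zero (NeZero.ne N)
  have hNpos : (0 : ℝ) < N := by linarith
  have hmono : ∀ {q : ℝ}, 0 < q → q ≤ (N : ℝ) * |(NumberField.discr K : ℝ)| →
      ((N : ℝ) * |(NumberField.discr K : ℝ)|) ^ (-ε) ≤ q ^ (-ε) := fun hq hle ↦
    Real.rpow_le_rpow_of_nonpos hq hle (by linarith)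
  rcases classGroupLFunction₀_eq_zero_imp h2 κ hoddp htwo hψ hagree hβ with h | h
  · -- a zero of `L(s, χ₁)`, modulus `N ≤ N|d|`
    have h1 := hSiegel N χ₁ hχ₁2 hχ₁ β h
    refine le_trans (mul_le_mul_of_nonneg_left (hmono hNpos ?_) hC.le) h1
    nlinarith
  · -- a zero of `L(s, χ₁κ)`, modulus `N |d|`
    have h1 := hSiegel (N * M) (twistKroneckerChar χ₁ κ) hκ₂2 hκ₂ β h
    refine le_trans ?_ h1
    push_cast
    rw [hMd, hdR]

section Genus

variable {K : Type*} [Field K] [NumberField K]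

/-- The modulus `D₁ = ∏_{p ∈ S} p` of the set `S` of odd ramified primes. [folklore] -/
def genusModulus (S : Finset ℕ) : ℕ := ∏ p ∈ S, p

/-- `D₁ ≠ 0` for a set of primes. [folklore] -/
theorem genusModulus_ne_zero {S : Finset ℕ} (hS : ∀ p ∈ S, p ≠ 0) : genusModulus S ≠ 0 :=
  Finset.prod_ne_zero_iff.mpr hS

/-- `J(a | ∏ p) = ∏ J(a | p)`. [folklore] -/
theorem jacobiSym_finsetProd (a : ℤ) {S : Finset ℕ} (hS : ∀ p ∈ S, p ≠ 0) :
    J(a | ∏ p ∈ S, p) = ∏ p ∈ S, J(a | p) := by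
  classical
  induction S using Finset.induction_on with
  | empty => simp [jacobiSym.one_right]
  | insert q S hq ih =>
    have hS' : ∀ p ∈ S, p ≠ 0 := fun p hp ↦ hS p (Finset.mem_insert_of_mem hp)
    rw [Finset.prod_insert hq, Finset.prod_insert hq,
      jacobiSym.mul_right' a (hS q (Finset.mem_insert_self q S)) (Finset.prod_ne_zero_iff.mpr hS'),
      ih hS']

/-- **The product of genus characters `ψ_S = ∏_{p ∈ S} ψ_p : Cl_K →* ℂˣ`** over a finite set `S` of
odd primes dividing `d_K`. [cite: Cox2013, §3.B Thm. 3.15] -/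
def genusCharProd (hK : IsImaginaryQuadratic K) (S : Finset ℕ)
    (hS : ∀ p ∈ S, p.Prime ∧ p ≠ 2 ∧ (p : ℤ) ∣ NumberField.discr K) : ClassGroup (𝓞 K) →* ℂˣ :=
  ∏ p ∈ S.attach, @genusChar K _ _ hK p.1 ⟨(hS p.1 p.2).1⟩ (hS p.1 p.2).2.1 (hS p.1 p.2).2.2

variable {hK : IsImaginaryQuadratic K} {S : Finset ℕ}
  {hS : ∀ p ∈ S, p.Prime ∧ p ≠ 2 ∧ (p : ℤ) ∣ NumberField.discr K}

/-- `(ψ_S(c) : ℂ) = ∏_{p ∈ S} (ψ_p(c) : ℂ)`. [folklore] -/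
theorem coe_genusCharProd_apply (c : ClassGroup (𝓞 K)) :
    ((genusCharProd hK S hS c : ℂˣ) : ℂ) =
      ∏ p ∈ S.attach, ((@genusChar K _ _ hK p.1 ⟨(hS p.1 p.2).1⟩ (hS p.1 p.2).2.1 (hS p.1 p.2).2.2 c :
        ℂˣ) : ℂ) := by
  rw [genusCharProd, MonoidHom.finsetProd_apply, Units.coe_prod]

/-- **`ψ_S` is real**: `ψ_S² = 1`. [folklore] -/
theorem genusCharProd_mul_self : genusCharProd hK S hS * genusCharProd hK S hS = 1 := by
  rw [genusCharProd, ← Finset.prod_mul_distrib]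
  refine Finset.prod_eq_one fun p _ ↦ ?_
  exact @genusChar_mul_self K _ _ hK p.1 ⟨(hS p.1 p.2).1⟩ (hS p.1 p.2).2.1 (hS p.1 p.2).2.2

/-- **`ψ_S([𝔞]) = (N𝔞 / D₁)`** for a nonzero integral ideal `𝔞` of norm prime to `D₁ = ∏_{p∈S} p`
(value by value `ψ_p([𝔞]) = (N𝔞/p)`, and `(N𝔞/D₁) = ∏_p (N𝔞/p)`). [cite: Cox2013, §3.B Thm. 3.15] -/
theorem genusCharProd_mk0_eq {I : Ideal (𝓞 K)} (hI : I ∈ (Ideal (𝓞 K))⁰)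
    (hcop : ∀ p ∈ S, ¬ (p : ℤ) ∣ Ideal.absNorm I) :
    ((genusCharProd hK S hS (ClassGroup.mk0 ⟨I, hI⟩) : ℂˣ) : ℂ) =
      (J(Ideal.absNorm I | genusModulus S) : ℂ) := by
  rw [coe_genusCharProd_apply, genusModulus,
    jacobiSym_finsetProd _ (fun p hp ↦ (hS p hp).1.ne_zero), Int.cast_prod, ← Finset.prod_attach S]
  refine Finset.prod_congr rfl fun p _ ↦ ?_
  haveI : Fact p.1.Prime := ⟨(hS p.1 p.2).1⟩
  rw [@genusChar_mk0_eq K _ _ hK p.1 ⟨(hS p.1 p.2).1⟩ (hS p.1 p.2).2.1 (hS p.1 p.2).2.2 I hI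
    (hcop p.1 p.2), jacobiSym.legendreSym.to_jacobiSym]

/-- **Genus characters are of Dirichlet type**: `ψ_S([𝔮]) = (N𝔮 / D₁)` for every prime `𝔮` of
norm prime to `D₁`. [cite: Cox2013, §3.B Thm. 3.15] -/
theorem genusCharProd_agree [NeZero (genusModulus S)] (v : HeightOneSpectrum (𝓞 K))
    (hv : (Ideal.absNorm v.asIdeal).Coprime (genusModulus S)) :
    classGroupCharPrimeValue (genusCharProd hK S hS) v =
      jacobiChar (genusModulus S) (Ideal.absNorm v.asIdeal) := by
  rw [classGroupCharPrimeValue_apply, jacobiChar_natCast]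
  refine genusCharProd_mk0_eq _ fun p hp hdvd ↦ ?_
  have hpD : p ∣ genusModulus S := Finset.dvd_prod_of_mem _ hp
  have h1 : p ∣ Nat.gcd (Ideal.absNorm v.asIdeal) (genusModulus S) :=
    Nat.dvd_gcd (Int.natCast_dvd_natCast.mp hdvd) hpD
  rw [hv] at h1
  exact (hS p hp).1.ne_one (Nat.dvd_one.mp h1)

/-! ### Arithmetic of `D₁` -/

/-- `D₁` is odd. [folklore] -/
theorem odd_genusModulus (hS' : ∀ p ∈ S, p.Prime ∧ p ≠ 2) : Odd (genusModulus S) := by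
  classical
  rw [genusModulus]
  induction S using Finset.induction_on with
  | empty => simp
  | insert q S hq ih =>
    rw [Finset.prod_insert hq]
    refine Nat.odd_mul.mpr ⟨?_, ih fun p hp ↦ hS' p (Finset.mem_insert_of_mem hp)⟩
    obtain ⟨hqp, hq2⟩ := hS' q (Finset.mem_insert_self q S)
    exact hqp.odd_of_ne_two hq2

/-- `D₁` is squarefree. [folklore] -/
theorem squarefree_genusModulus (hS' : ∀ p ∈ S, p.Prime) : Squarefree (genusModulus S) := by
  rw [genusModulus]
  refine Finset.squarefree_prod_of_pairwise_isCoprime (f := fun p : ℕ ↦ p) ?_ fun p hp ↦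
    (hS' p hp).prime.squarefree
  intro p hp q hq hpq
  exact Nat.coprime_iff_isRelPrime.mp ((Nat.coprime_primes (hS' p hp) (hS' q hq)).mpr hpq)

/-- `D₁ ∣ |d_K|`. [folklore] -/
theorem genusModulus_dvd_natAbs_discr (hS : ∀ p ∈ S, p.Prime ∧ p ≠ 2 ∧ (p : ℤ) ∣ NumberField.discr K) :
    genusModulus S ∣ (NumberField.discr K).natAbs :=
  Finset.prod_primes_dvd _ (fun p hp ↦ (hS p hp).1.prime) fun p hp ↦ Int.natCast_dvd.mp (hS p hp).2.2

/-- If `ψ_S ≠ 1` then `S ≠ ∅`. [folklore] -/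
theorem nonempty_of_genusCharProd_ne_one (h : genusCharProd hK S hS ≠ 1) : S.Nonempty := by
  rw [Finset.nonempty_iff_ne_empty]
  rintro rfl
  exact h (by rw [genusCharProd]; rfl)

/-- For `S ≠ ∅`: `(·/D₁) ≠ 1`. [folklore] -/
theorem jacobiChar_genusModulus_ne_one [NeZero (genusModulus S)]
    (hS' : ∀ p ∈ S, p.Prime ∧ p ≠ 2) (hne : S.Nonempty) : jacobiChar (genusModulus S) ≠ 1 := by
  refine jacobiChar_ne_one (odd_genusModulus hS') (squarefree_genusModulus fun p hp ↦ (hS' p hp).1) ?_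
  obtain ⟨p, hp⟩ := hne
  intro h1
  have hdvd : p ∣ genusModulus S := Finset.dvd_prod_of_mem _ hp
  rw [h1, Nat.dvd_one] at hdvd
  exact (hS' p hp).1.ne_one hdvd

end Genus

/-- **Lower bound for `1 − β` at real zeros of `L(s, ψ_S)`, uniformly over imaginary quadratic
fields**: for every `ε > 0` there is `C(ε) > 0` such that for every imaginary quadratic field `K`,
every finite set `S` of odd primes dividing `d_K` with `ψ_S ≠ 1`, and every real `β` with
`L₀(β, ψ_S) = 0`: `C |d_K|^{−ε} ≤ 1 − β` (`exists_one_sub_realZero_ge_of_agree` with `χ₁ = (·/D₁)`,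
`D₁ ≤ |d_K|`, at `ε/2`). [cite: ThornerZaman2019, Thm. 3.3] -/
theorem exists_one_sub_realZero_genusCharProd_ge {ε : ℝ} (hε : 0 < ε) :
    ∃ C : ℝ, 0 < C ∧ ∀ (K : Type) [Field K] [NumberField K] (hK : IsImaginaryQuadratic K)
      (S : Finset ℕ) (hS : ∀ p ∈ S, p.Prime ∧ p ≠ 2 ∧ (p : ℤ) ∣ NumberField.discr K),
      genusCharProd hK S hS ≠ 1 → ∀ β : ℝ,
        classGroupLFunction₀ K (genusCharProd hK S hS) β = 0 →
          C * (|(NumberField.discr K : ℝ)|) ^ (-ε) ≤ 1 - β := by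
  obtain ⟨C, hC, h⟩ := exists_one_sub_realZero_ge_of_agree (half_pos hε)
  refine ⟨C, hC, fun K _ _ hK S hS hψ β hβ ↦ ?_⟩
  haveI : NeZero (genusModulus S) := ⟨genusModulus_ne_zero fun p hp ↦ (hS p hp).1.ne_zero⟩
  have hχ₁2 : jacobiChar (genusModulus S) ^ 2 = 1 :=
    MulChar.IsQuadratic.sq_eq_one (fun a ↦ jacobiChar_trichotomy a)
  have h1 := h K hK.1 (genusModulus S) (jacobiChar (genusModulus S)) hχ₁2 (genusCharProd hK S hS) hψ
    (fun v hv ↦ genusCharProd_agree v hv) β hβ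
  refine le_trans ?_ h1
  have hd0 : 0 < (NumberField.discr K).natAbs := Int.natAbs_pos.mpr (NumberField.discr_ne_zero K)
  have hdR : ((NumberField.discr K).natAbs : ℝ) = |(NumberField.discr K : ℝ)| := by
    rw [Nat.cast_natAbs, Int.cast_abs]
  have hd1 : (1 : ℝ) ≤ |(NumberField.discr K : ℝ)| := by rw [← hdR]; exact_mod_cast hd0
  have hD₁le : (genusModulus S : ℝ) ≤ |(NumberField.discr K : ℝ)| := by
    rw [← hdR]
    exact_mod_cast Nat.le_of_dvd hd0 (genusModulus_dvd_natAbs_discr hS)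
  have hD₁pos : (0 : ℝ) < genusModulus S := by exact_mod_cast Nat.pos_of_ne_zero (NeZero.ne _)
  refine mul_le_mul_of_nonneg_left ?_ hC.le
  calc |(NumberField.discr K : ℝ)| ^ (-ε)
      = (|(NumberField.discr K : ℝ)| ^ (2 : ℝ)) ^ (-(ε / 2)) := by
        rw [← Real.rpow_mul (by linarith)]; congr 1; ring
    _ ≤ ((genusModulus S : ℝ) * |(NumberField.discr K : ℝ)|) ^ (-(ε / 2)) := by
        refine Real.rpow_le_rpow_of_nonpos (mul_pos hD₁pos (by linarith)) ?_ (by linarith)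
        rw [Real.rpow_two, sq]
        exact mul_le_mul_of_nonneg_right hD₁le (abs_nonneg _)

end Literature.NumberTheory.QuadraticFields.Quadratic

end
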